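import Summits.QuantumAdvantage.QuantumAdvantage.Theorems.LinnikCubicClassGroupsDegreeOnePrimesEscapeDivisionPNTBounds
import Literature.NumberTheory.LFunctions.ClassGroupLFunctionExceptionalZeroQuadraticField
import Literature.NumberTheory.LFunctions.DedekindZetaEntireConvexity
import HarnessLib

/-!
# The Siegel–Walfisz theorem for Frobenius divisions: no exceptional term for `log x ≥ C |d_N|^{ε'}`

Topic `Summits/QuantumAdvantage/QuantumAdvantage/Theorems`, cell B2b-1 (linnik-cubic), PART A (gen 10);
helper toward the crux `DegreeOnePrimesEscape` (stmt-QuantumAdvantage-11543) of route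
`LinnikCubicClassGroups`.  HONEST FRAMING: the value of this file is a THEOREM (kernel-checked, GRH-free, no
hypothesis; the constant is INEFFECTIVE through Siegel's theorem) — NOT summit progress.

**Theorem** (`division_PNT_siegelWalfisz`).  For `n > 1`, `0 < ε ≤ 1` and `ε' > 0` there is `C = C(n, ε, ε') > 0`
such that for every Galois number field `N` of degree `n`, every `σ ∈ Gal(N/ℚ)` and every
`x ≥ exp(C |d_N|^{ε'})`:  `|S(x) − δ x| ≤ ε δ x`, where `δ = |Div σ|/|G|` and
`S(x) = Σ_{p ≤ x, p ∤ d_N, Frob_p ∈ Div σ} log p`.  (Chebotarev–Siegel–Walfisz for divisions: in the range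
`x ≥ exp(C |d_N|^{ε'})` the exceptional term of `division_PNT` is swallowed, since Siegel's theorem for `ζ_N`
(`dedekindZeta_cont_siegel`, every degree) gives `1 − β₁ ≥ C_S |d_N|^{−ε'}` and then `x^{β₁}/β₁ ≤ ε x`.)
[cite: LagariasMontgomeryOdlyzko1979, Theorem 1.1] [cite: Stark1974, §1]
-/

noncomputable section

open scoped NumberField nonZeroDivisors
open Finset Real Ideal NumberField
open Literature.NumberTheory.NumberFields Literature.NumberTheory.LFunctions
  Literature.NumberTheory.LFunctions.NumberField

namespace Summit.QuantumAdvantage.QuantumAdvantage.Theorems.DegreeOnePrimesEscape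

set_option maxHeartbeats 1600000 in
open scoped Classical in
/-- **Siegel–Walfisz for Frobenius divisions** (see the module docstring): for `n > 1`, `0 < ε ≤ 1`, `ε' > 0`
there is an (ineffective) `C > 0` with `|S(x) − δ x| ≤ ε δ x` for every Galois `N` of degree `n`, every `σ`
and every `x ≥ exp(C |d_N|^{ε'})`.  Unconditional. [cite: LagariasMontgomeryOdlyzko1979, Theorem 1.1] -/
theorem division_PNT_siegelWalfisz (n : ℕ) (hn : 1 < n) {ε ε' : ℝ} (hε : 0 < ε) (hε1 : ε ≤ 1) (hε' : 0 < ε') :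
    ∃ C : ℝ, 0 < C ∧ ∀ (N : Type) [Field N] [NumberField N] [IsGalois ℚ N],
      Module.finrank ℚ N = n → ∀ σ : N ≃ₐ[ℚ] N, ∀ x : ℝ,
        Real.exp (C * ((NumberField.discr N).natAbs : ℝ) ^ ε') ≤ x →
          |∑ p ∈ (Nat.primesLE ⌊x⌋₊).filter
              (fun p : ℕ => ¬ ((p : ℤ) ∣ NumberField.discr N) ∧
                ∃ (Q : Ideal (𝓞 N)) (_ : Q.IsMaximal) (_ : Q.LiesOver (span {(p : ℤ)})) (φ g : N ≃ₐ[ℚ] N),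
                  IsArithFrobAt ℤ φ Q ∧ Q.inertia (N ≃ₐ[ℚ] N) = ⊥ ∧
                    Subgroup.zpowers (g * φ * g⁻¹) = Subgroup.zpowers σ), Real.log p -
            (Nat.card {τ : N ≃ₐ[ℚ] N // ∃ g : N ≃ₐ[ℚ] N,
                Subgroup.zpowers (g * τ * g⁻¹) = Subgroup.zpowers σ} : ℝ) / Nat.card (N ≃ₐ[ℚ] N) * x| ≤
            ε * ((Nat.card {τ : N ≃ₐ[ℚ] N // ∃ g : N ≃ₐ[ℚ] N,
                Subgroup.zpowers (g * τ * g⁻¹) = Subgroup.zpowers σ} : ℝ) / Nat.card (N ≃ₐ[ℚ] N) * x) := by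
  set ε₀ : ℝ := ε / 3 with hε₀
  have hε₀0 : 0 < ε₀ := by positivity
  have hε₀1 : ε₀ ≤ 1 := by rw [hε₀]; linarith
  obtain ⟨L, c, hL, hc, hc4, h⟩ := division_PNT n hn hε₀0 hε₀1
  obtain ⟨CS, hCS, hS⟩ := dedekindZetaCont_siegel n hn hε'
  have hlog4ε : 0 < Real.log (4 / ε₀) := Real.log_pos (by rw [lt_div_iff₀ hε₀0]; linarith)
  set C : ℝ := L / ε' + Real.log (4 / ε₀) / CS with hC
  have hC0 : 0 < C := by positivity
  refine ⟨C, hC0, fun N _ _ _ hN σ x hx => ?_⟩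
  obtain ⟨hA, hB⟩ := h N hN σ
  obtain ⟨hδ0, hδ1⟩ := divisionDensity_pos_le_one σ
  set δ : ℝ := (Nat.card {τ : N ≃ₐ[ℚ] N // ∃ g : N ≃ₐ[ℚ] N,
      Subgroup.zpowers (g * τ * g⁻¹) = Subgroup.zpowers σ} : ℝ) / Nat.card (N ≃ₐ[ℚ] N) with hδ
  have hN1 : 1 < Module.finrank ℚ N := by rw [hN]; exact hn
  set d : ℝ := ((NumberField.discr N).natAbs : ℝ) with hd
  have hd3 : (3 : ℝ) ≤ d := three_le_natAbs_discr_real N hN1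
  have hd0 : (0 : ℝ) < d := by linarith
  have hdε : 0 < d ^ ε' := Real.rpow_pos_of_pos hd0 _
  -- the range: `log x ≥ C d^{ε'} ≥ L log d`, so `x ≥ d^L`
  have hlogd : Real.log d ≤ d ^ ε' / ε' := Real.log_le_rpow_div hd0.le hε'
  have hLlog : L * Real.log d ≤ C * d ^ ε' := by
    have h1 : L * Real.log d ≤ L / ε' * d ^ ε' := by
      have h0 : Real.log d * ε' ≤ d ^ ε' := (le_div_iff₀ hε').mp hlogd
      rw [div_mul_eq_mul_div, le_div_iff₀ hε']
      nlinarith [mul_le_mul_of_nonneg_left h0 hL.le]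
    have h2 : L / ε' * d ^ ε' ≤ C * d ^ ε' :=
      mul_le_mul_of_nonneg_right (by rw [hC]; linarith [div_pos hlog4ε hCS |>.le]) hdε.le
    exact h1.trans h2
  have hxpos : 0 < x := lt_of_lt_of_le (Real.exp_pos _) hx
  have hx' : C * d ^ ε' ≤ Real.log x := by
    rw [Real.le_log_iff_exp_le hxpos]; exact hx
  have hlogx : L * Real.log d ≤ Real.log x := hLlog.trans hx'
  have hxL : d ^ L ≤ x := by
    rw [← Real.log_le_log_iff (Real.rpow_pos_of_pos hd0 L) hxpos, Real.log_rpow hd0]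
    exact hlogx
  have hx1 : 1 ≤ x := le_trans (Real.one_le_rpow (by linarith) hL.le) hxL
  have hδx : 0 ≤ δ * x := by positivity
  by_cases hexc : ∃ β₁ : ℝ, dedekindZeta₁ N β₁ = 0 ∧ 1 - c / (Real.log d + Real.log 4) < β₁ ∧ β₁ < 1
  · obtain ⟨β₁, hζ₁, hβ₁c, hβ₁1⟩ := hexc
    have hβ34 : 3 / 4 ≤ β₁ := three_quarters_le_of_window hc hc4 hd3 hβ₁c
    have hβ0 : 0 < β₁ := by linarith
    -- Siegel: `1 − β₁ ≥ C_S d^{−ε'}`, hence `x^{β₁}/β₁ ≤ ε₀ x`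
    have hcont : dedekindZetaCont N β₁ = 0 := by
      have := dedekindZetaCont_eq_zero_of_dedekindZeta₁_eq_zero (K := N) hζ₁
      exact this.2
    have hsieg : CS * d ^ (-ε') ≤ 1 - β₁ := hS N hN β₁ hβ₁1 hcont
    have hy : x ^ β₁ / β₁ ≤ ε₀ * x := by
      have hdd : d ^ (-ε') * d ^ ε' = 1 := by
        rw [← Real.rpow_add hd0, neg_add_cancel, Real.rpow_zero]
      have hexp : (β₁ - 1) * Real.log x ≤ -Real.log (4 / ε₀) := by
        have h1 : (β₁ - 1) * Real.log x ≤ -(CS * d ^ (-ε')) * Real.log x :=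
          mul_le_mul_of_nonneg_right (by linarith) (Real.log_nonneg hx1)
        have h2 : CS * d ^ (-ε') * Real.log x ≥ CS * d ^ (-ε') * (C * d ^ ε') :=
          mul_le_mul_of_nonneg_left hx' (by positivity)
        have h3 : CS * d ^ (-ε') * (C * d ^ ε') = CS * C := by
          calc CS * d ^ (-ε') * (C * d ^ ε') = CS * C * (d ^ (-ε') * d ^ ε') := by ring
            _ = CS * C := by rw [hdd, mul_one]
        have h4 : Real.log (4 / ε₀) ≤ CS * C := by
          rw [hC, mul_add, mul_div_cancel₀ _ hCS.ne']
          have : 0 ≤ CS * (L / ε') := by positivity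
          linarith
        linarith
      have hxβ : x ^ β₁ = x * Real.exp ((β₁ - 1) * Real.log x) := by
        have : x ^ β₁ = x ^ (1 : ℝ) * x ^ (β₁ - 1) := by rw [← Real.rpow_add hxpos]; ring_nf
        rw [this, Real.rpow_one, Real.rpow_def_of_pos hxpos]; ring_nf
      have hexp' : Real.exp ((β₁ - 1) * Real.log x) ≤ ε₀ / 4 := by
        calc Real.exp ((β₁ - 1) * Real.log x) ≤ Real.exp (-Real.log (4 / ε₀)) := Real.exp_le_exp.mpr hexp
          _ = ε₀ / 4 := by rw [Real.exp_neg, Real.exp_log (by positivity)]; field_simp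
      rw [div_le_iff₀ hβ0, hxβ]
      have h1 : x * Real.exp ((β₁ - 1) * Real.log x) ≤ x * (ε₀ / 4) := mul_le_mul_of_nonneg_left hexp' hxpos.le
      have h2 : x * (ε₀ / 4) ≤ ε₀ * x * β₁ := by nlinarith [mul_pos hε₀0 hxpos]
      linarith
    have hy0 : 0 ≤ x ^ β₁ / β₁ := div_nonneg (Real.rpow_nonneg hxpos.le _) hβ0.le
    obtain ⟨hB1, hB2⟩ := hB β₁ hζ₁ hβ₁c hβ₁1
    by_cases hζσ : dedekindZeta₁ (IntermediateField.fixedField (Subgroup.zpowers σ)) β₁ = 0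
    · obtain ⟨hxy, hb⟩ := hB1 hζσ x hxL
      rw [abs_le] at hb ⊢
      have hδy : δ * (x ^ β₁ / β₁) ≤ δ * (ε₀ * x) := mul_le_mul_of_nonneg_left hy hδ0.le
      constructor <;> nlinarith [hb.1, hb.2, mul_nonneg hδ0.le hy0]
    · have hb := hB2 hζσ x hxL
      rw [abs_le] at hb ⊢
      have hδy : δ * (x ^ β₁ / β₁) ≤ δ * (ε₀ * x) := mul_le_mul_of_nonneg_left hy hδ0.le
      constructor <;> nlinarith [hb.1, hb.2, mul_nonneg hδ0.le hy0]
  · have hb := hA hexc x hxL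
    rw [abs_le] at hb ⊢
    constructor <;> nlinarith [hb.1, hb.2]

end Summit.QuantumAdvantage.QuantumAdvantage.Theorems.DegreeOnePrimesEscape

end
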